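import Mathlib
import HarnessLib
import Summits.Parity.GeneralizedHardyLittlewood.Theses.SiegelSpectrumSplit

/-!
# The PROVED sibling word of `EqualGapTriple`: `d_n < d_{n+1}` infinitely often (Erdős–Turán 1948)
# (bc5 rung for the catalogue item stmt-Parity-32337 beneath `FixedLower` 26863)

decomp-parity node «ConsecutivePrimeWords» (lens-3 g7; critic CLEARED CRITIC-LEDGER row 79; record catalogue items
`SiegelSpectrumSplit.DecadeStep` = stmt-Parity-32327 / `.EqualGapTriple` = stmt-Parity-32337, writer l.448): the
lens's hand `HOME/decomp-parity-lens-3/g7/hand/FixedLowerConsecutivePrimeWords.lean` (sha16 3e140b9178ad74b4, critic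
ENDORSED STATUS l.467) = the necessity/exactness package (landed separately as
`Theorems/ConsecutivePrimeWordsNecessity.lean`, same texts on the record decls) + THIS rung, its §7, ported verbatim
by the cell's prover-class seat census-1 g10: the increasing gap word "<" is DECIDED where the crux's "=" is open.
If from some point on every consecutive triple had `d_{n+1} ≤ d_n`, the gaps would be eventually constant `G ≥ 1`
and the primes an infinite arithmetic progression `P, P+G, …` whose `P`-th term `P(1+G)` is composite.
`increasingWord_vs_equalGapTriple` records the comparison with the catalogue item's text.  0 sorry.
-/

namespace Summit.Parity.GeneralizedHardyLittlewood.ConsecutivePrimeWords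

/-! ## §7 BC5 rung for `EqualGapTriple` (PROVED): the increasing gap word `d_n < d_(n+1)` infinitely often
(Erdős–Turán 1948) — the sibling word "<" of the crux's "=", decided where the crux is not.  If from some point on every
consecutive triple had `d_(n+1) ≤ d_n`, the gaps would be eventually constant `G ≥ 1` and the primes an infinite arithmetic
progression `P, P+G, …` whose `P`-th term `P(1+G)` is composite. -/

namespace Rung


/-- the `i`-th prime (0-indexed). -/
noncomputable def pr (i : ℕ) : ℕ := Nat.nth Nat.Prime i

/-- `pr` is strictly increasing. -/
theorem pr_strictMono : StrictMono pr := Nat.nth_strictMono Nat.infinite_setOf_prime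

/-- `pr i` is prime. -/
theorem pr_prime (i : ℕ) : (pr i).Prime := Nat.prime_nth_prime i

/-- `pr` inverts the prime-counting index: `pr (count m) = m` for `m` prime. -/
theorem pr_count {m : ℕ} (hm : m.Prime) : pr (Nat.count Nat.Prime m) = m := Nat.nth_count hm

/-- `i ≤ pr i`. -/
theorem le_pr (i : ℕ) : i ≤ pr i := pr_strictMono.le_apply

/-- the only prime strictly between `pr i` and `pr (i+2)` is `pr (i+1)`. -/
theorem eq_pr_succ_of_between {i m : ℕ} (h1 : pr i < m) (h2 : m < pr (i + 2)) (hm : m.Prime) :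
    m = pr (i + 1) := by
  have hc := pr_count hm
  rw [← hc] at h1 h2 ⊢
  have a : i < Nat.count Nat.Prime m := pr_strictMono.lt_iff_lt.mp h1
  have b : Nat.count Nat.Prime m < i + 2 := pr_strictMono.lt_iff_lt.mp h2
  have : Nat.count Nat.Prime m = i + 1 := by omega
  rw [this]

/-- consecutive gaps. -/
noncomputable def gap (i : ℕ) : ℕ := pr (i + 1) - pr i

/-- Consecutive gaps are positive. -/
theorem gap_pos (i : ℕ) : 0 < gap i := by
  have := pr_strictMono (Nat.lt_add_one i)
  unfold gap; omega

/-- `pr (i+1) = pr i + gap i`. -/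
theorem pr_succ (i : ℕ) : pr (i + 1) = pr i + gap i := by
  have := (pr_strictMono (Nat.lt_add_one i)).le
  unfold gap; omega

/-- **Erdős–Turán 1948**: `d_n < d_(n+1)` for infinitely many `n`, in the consecutive-triple form of the route. -/
theorem increasingWord :
    ∀ N : ℕ, ∃ p q r : ℕ, N ≤ p ∧ p < q ∧ q < r ∧ Nat.Prime p ∧ Nat.Prime q ∧ Nat.Prime r ∧
      (∀ m : ℕ, p < m → m < r → Nat.Prime m → m = q) ∧ q - p < r - q := by
  by_contra h
  push Not at h
  obtain ⟨N, hN⟩ := h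
  -- one step of the hypothesis on the consecutive triple (pr i, pr (i+1), pr (i+2)), i ≥ N
  have step : ∀ i, N ≤ i → gap (i + 1) ≤ gap i := by
    intro i hi
    have h01 := pr_strictMono (Nat.lt_add_one i)
    have h12 := pr_strictMono (Nat.lt_add_one (i + 1))
    have hle := hN (pr i) (pr (i + 1)) (pr (i + 2)) (hi.trans (le_pr i)) h01 h12 (pr_prime i)
      (pr_prime (i + 1)) (pr_prime (i + 2)) (fun m hm1 hm2 hm => eq_pr_succ_of_between hm1 hm2 hm)
    unfold gap
    exact hle
  -- antitone from N on
  have anti : ∀ i, N ≤ i → ∀ j, gap (i + j) ≤ gap i := by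
    intro i hi j
    induction j with
    | zero => simp
    | succ j ih =>
      have := step (i + j) (by omega)
      rw [show i + (j + 1) = i + j + 1 by omega]
      exact this.trans ih
  -- a minimal gap value beyond N is attained at some i₀ ≥ N
  have hex : ∃ v, ∃ i, N ≤ i ∧ gap i = v := ⟨gap N, N, le_rfl, rfl⟩
  classical
  obtain ⟨i₀, hi₀, hgi₀⟩ := Nat.find_spec hex
  have hmin : ∀ i, N ≤ i → gap i₀ ≤ gap i := by
    intro i hi
    have := Nat.find_min' hex ⟨i, hi, rfl⟩
    rw [hgi₀]; exact this
  -- hence the gaps are constant = G from i₀ on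
  have const : ∀ j, gap (i₀ + j) = gap i₀ := fun j =>
    le_antisymm (anti i₀ hi₀ j) (hmin (i₀ + j) (by omega))
  -- so the primes form an arithmetic progression from i₀ on
  have ap : ∀ j, pr (i₀ + j) = pr i₀ + j * gap i₀ := by
    intro j
    induction j with
    | zero => simp
    | succ j ih =>
      rw [show i₀ + (j + 1) = i₀ + j + 1 by omega, pr_succ, ih, const j]
      ring
  -- the P-th term, P = pr i₀, is P * (1 + G): composite
  have hP := pr_prime i₀
  have hG := gap_pos i₀
  have hbad : (pr (i₀ + pr i₀)).Prime := pr_prime _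
  rw [ap (pr i₀), show pr i₀ + pr i₀ * gap i₀ = pr i₀ * (1 + gap i₀) by ring, Nat.prime_mul_iff] at hbad
  rcases hbad with ⟨-, h1⟩ | ⟨-, h1⟩
  · omega
  · exact hP.one_lt.ne' h1


end Rung

/-- The rung and the crux side by side: `Rung.increasingWord` is the record item `EqualGapTriple`
(stmt-Parity-32337) with the last conjunct `q - p = r - q` replaced by `q - p < r - q` — same quantifier
block, same consecutive-triple clause (the `Nat.Prime p` / `p.Prime` spellings are definitionally equal). -/
theorem increasingWord_vs_equalGapTriple :
    (Summit.Parity.GeneralizedHardyLittlewood.Theses.SiegelSpectrumSplit.EqualGapTriple ↔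
      ∀ N : ℕ, ∃ p q r : ℕ, N ≤ p ∧ p < q ∧ q < r ∧ Nat.Prime p ∧ Nat.Prime q ∧ Nat.Prime r ∧
        (∀ m : ℕ, p < m → m < r → Nat.Prime m → m = q) ∧ q - p = r - q) ∧
    (∀ N : ℕ, ∃ p q r : ℕ, N ≤ p ∧ p < q ∧ q < r ∧ Nat.Prime p ∧ Nat.Prime q ∧ Nat.Prime r ∧
        (∀ m : ℕ, p < m → m < r → Nat.Prime m → m = q) ∧ q - p < r - q) :=
  ⟨Iff.rfl, Rung.increasingWord⟩

end Summit.Parity.GeneralizedHardyLittlewood.ConsecutivePrimeWords
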